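import Summits.RiemannHypothesis.RiemannHypothesis.Theorems.Splittings.RobinFiniteSqrtWindowCover
import HarnessLib

/-!
# RobinFiniteSqrtWindowLaw — gen 16 «Q-SCALE √-WINDOW LIFTS THE LEVEL BUDGETS», part 4/5: the low-height law on the lifted budgets (partial top level allowed), the tolerances `tolS`, the rows

Cell rh-split, seat rh-split-robin-finite g16 (card `cards/SPLIT-robin-finite.md` §23).

THE LEVER (gen 16).  The landed cell certificates (`RobinAnalyticSharp.cover11 … cover17`, budgets `b₁₁ … b₁₇ = 0.105 … 0.50`) price the
SECOND prime `Q` with Schoenfeld's RH-form relative error `δ(Q) = log²Q/(8π√Q)` two-sided.  Büthe 2018 Thm 2 (`Buthe2018_thm2_theta`,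
already a hypothesis of every low-height row) gives the ONE-SIDED `√`-window `y − 1.95√y ≤ θ(y) ≤ y` (`1423 ≤ y ≤ 10¹⁹`):
`δ_l(Q) = 1.95/√Q`, `δ_u = 0`, `δ(P) ↦ 0`.  Re-certifying the SAME covers (`coverOKS`, `decide +kernel`) lifts the budgets to
`b'₁₁ … b'₁₇ = 0.208, 0.332, 0.405, 0.461, 0.504, 0.538, 0.564`; Büthe 2016 and the range condition drop out below `10¹⁹`.
Rows (RH(T) in hypothesis position): `RH(10⁵) ⟹ robinCA_below 55 000 001`; `4¹³ ← RH(124 000)`, `4¹⁴ ← RH(212 000)`,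
`4¹⁵ ← RH(364 000)`, `4¹⁶ ← RH(705 000)`, `4¹⁷ ← RH(1.4·10⁶)`, `4¹⁸ ← RH(2.65·10⁶)` (tree: —, 330 000, 500 000, 860 000, 1.62·10⁶, 3·10⁶).

HONEST LABEL: SPLITTING SEARCH over kernel-typed RH-EQUIVALENCES; a splitting A ∧ B ⟹ RH is CONDITIONAL
bookkeeping unless A and B are both proved; nothing here bears on the truth of RH.

This part (1 `def`, 15 theorems): S5 `mertensProdLt_levelS`, `mertensProdLt_lowS`, `robinCA_below_lowS` (the tree's `…_level / _low / robinCA_below_low` re-run on `key_ineq_levelS`,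
with `θ`-facts from `thetaWindow_ofB` and the top level allowed PARTIAL: `√(min X 4^{k+1})`), `tolS`, `levelS_of_tol`, `robinCA_below_cellsS`, and the rows
`robinCA_below_of_rh100000S` (`4¹²`), `robinCA_below_55e6_of_rh100000` (`55 000 001`), `robin_le_of_rh100000S`, `robin_le_ten_pow_of_rh100000S`
(`n ≤ 10^23 870 000`), `robinCA_below_of_rh{124000,212000,364000,705000,1400000,2650000}S` (`4¹³ … 4¹⁸`).
-/

set_option linter.dupNamespace false

noncomputable section

open Real Filter Finset
open scoped Chebyshev

namespace Summit.RiemannHypothesis.RiemannHypothesis.Theorems.Splittings.RobinFiniteC1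

open Literature.NumberTheory.LFunctions Literature.NumberTheory.DiophantineGeometry
open RobinAnalyticSharp RobinAnalyticSharp.Cells
open Summit.RiemannHypothesis.RiemannHypothesis.Theorems.Splittings.RobinFiniteE3

section SqrtWindowLaw

/-! ### S5 · the low-height law on the lifted budgets (cells below `4¹⁸`; the top level may be partial)

Shape of `RobinFiniteLowHeightLaw` C/E and `RobinFiniteLowHeightRanges` F with `bk ↦ bkS`, `key_ineq_levelB ↦ key_ineq_levelS`,
the window `thetaWindow_low h16 … ↦ thetaWindow_ofB hB` (so Büthe 2016 and Büthe's range condition disappear), and a PARTIAL top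
level (`P ≤ Y`, budget priced at `√Y` instead of `2ᵏ⁺¹`). -/

/-- **One level on the lifted budget, partial levels allowed**: the CA Mertens inequality for `4ᵏ ≤ P ≤ 4ᵏ⁺¹`, `P ≤ Y`,
`Q ≤ P` (`11 ≤ k ≤ 17`) at any height `T ≥ 10⁵` with `RH(T)`, under `0.0463 + (1 + 2/L1 k)·tailH(T)·√Y ≤ b'_k`
(`negLog_le_Eb_point` on the window `thetaWindow_ofB`, `key_ineq_levelS`, `mertens_prod_lt_of`). -/
theorem mertensProdLt_levelS (hB : Buthe2018_thm2_theta) (hK : BroadbentEtAl2021_theta_rel_1e19)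
    {T : ℝ} (hT : 100000 ≤ T) (hRH : RiemannHypothesisUpTo T) {k : ℕ} (hk11 : 11 ≤ k) (hk17 : k ≤ 17) {Y : ℝ}
    (hlev : 0.0463 + (1 + 2 / ((L1 k : ℚ) : ℝ)) *
      ((((Real.log (T / (2 * π)) + 1) / (π * T) + (184 + 30 * Real.log T) / T ^ 2)) * √Y) ≤ ((bkS k : ℚ) : ℝ))
    {P Q : ℕ} (hPl : 4 ^ k ≤ P) (hPu : P ≤ 4 ^ (k + 1)) (hPY : (P : ℝ) ≤ Y) (hQP : Q ≤ P) :
    (∏ p ∈ Nat.primesLE P, (1 - (p : ℝ)⁻¹))⁻¹ *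
        ∏ p ∈ (Nat.primesLE P).filter (fun p => Q < p), (1 - ((p : ℝ) ^ 2)⁻¹) <
      rexp eulerMascheroniConstant * Real.log (θ P + θ Q) := by
  have hT7 : (7 : ℝ) ≤ T := by linarith
  have ht0 := Summit.RiemannHypothesis.RiemannHypothesis.Theorems.Splittings.RobinFiniteTail.tailH_nonneg hT7
  obtain ⟨hP₁599, hL₁, -, -, hL₁8, -, -⟩ := range_facts (k := k) (by omega)
  have hPr : (4 : ℝ) ^ k ≤ P := by exact_mod_cast hPl
  have hPur : (P : ℝ) ≤ (4 : ℝ) ^ (k + 1) := by exact_mod_cast hPu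
  have hP599 : (599 : ℝ) ≤ P := hP₁599.trans hPr
  have hP11 : 4 ^ 11 ≤ P := le_trans (Nat.pow_le_pow_right (by norm_num) hk11) hPl
  have hPB : (P : ℝ) ≤ (10 : ℝ) ^ 19 :=
    hPur.trans ((pow_le_pow_right₀ (by norm_num) (by omega : k + 1 ≤ 18)).trans (by norm_num))
  have hL₁0 : (0 : ℝ) < ((L1 k : ℚ) : ℝ) := by linarith
  have hW := thetaWindow_ofB hB
  have hlow := negLog_le_Eb_point hB hK hT7 hRH hW hP599 hPB
  have hlogP : ((L1 k : ℚ) : ℝ) ≤ Real.log P := hL₁.trans (Real.log_le_log (by positivity) hPr)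
  have h2 : 2 / Real.log (P : ℝ) ≤ 2 / ((L1 k : ℚ) : ℝ) := div_le_div_of_nonneg_left (by norm_num) hL₁0 hlogP
  have h2' : (0 : ℝ) ≤ 2 / Real.log (P : ℝ) := div_nonneg (by norm_num) (hL₁0.le.trans hlogP)
  have hsP : √(P : ℝ) ≤ √Y := Real.sqrt_le_sqrt hPY
  set t : ℝ := (Real.log (T / (2 * π)) + 1) / (π * T) + (184 + 30 * Real.log T) / T ^ 2 with ht_def
  have h3 : t * √(P : ℝ) ≤ t * √Y := mul_le_mul_of_nonneg_left hsP ht0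
  have h4 : (1 + 2 / Real.log (P : ℝ)) * (t * √(P : ℝ)) ≤ (1 + 2 / ((L1 k : ℚ) : ℝ)) * (t * √Y) :=
    mul_le_mul (by linarith) h3 (mul_nonneg ht0 (Real.sqrt_nonneg _)) (by linarith)
  have hbud : 0.0463 + (1 + 2 / Real.log (P : ℝ)) * (t * √(P : ℝ)) ≤ ((bkS k : ℚ) : ℝ) := by linarith
  have hkey := key_ineq_levelS hB hk11 hk17 hPl hPu hQP hbud
  exact mertens_prod_lt_of hW hP11 hPB hlow hkey

/-- **THE LIFTED LOW-HEIGHT CA MERTENS LAW below `4¹⁸`** (cells only, top level partial): at any height `T ≥ 10⁵` with `RH(T)`,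
the CA Mertens inequality for `4¹¹ ≤ P ≤ X`, `Q ≤ P` (`X < 4¹⁸` real), provided every level `4ᵏ ≤ X` (`11 ≤ k ≤ 17`) passes
`0.0463 + (1 + 2/L1 k)·tailH(T)·√(min X 4ᵏ⁺¹) ≤ b'_k`.  Dispatch on `k = Nat.log 4 P`. -/
theorem mertensProdLt_lowS (hB : Buthe2018_thm2_theta) (hK : BroadbentEtAl2021_theta_rel_1e19)
    {T : ℝ} (hT : 100000 ≤ T) (hRH : RiemannHypothesisUpTo T) {X : ℝ} (hX18 : X < (4 : ℝ) ^ 18)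
    (hcell : ∀ k : ℕ, 11 ≤ k → k ≤ 17 → (4 : ℝ) ^ k ≤ X → 0.0463 + (1 + 2 / ((L1 k : ℚ) : ℝ)) *
      ((((Real.log (T / (2 * π)) + 1) / (π * T) + (184 + 30 * Real.log T) / T ^ 2)) * √(min X ((4 : ℝ) ^ (k + 1)))) ≤
        ((bkS k : ℚ) : ℝ))
    {P Q : ℕ} (hP : 4 ^ 11 ≤ P) (hPX : (P : ℝ) ≤ X) (hQP : Q ≤ P) :
    (∏ p ∈ Nat.primesLE P, (1 - (p : ℝ)⁻¹))⁻¹ *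
        ∏ p ∈ (Nat.primesLE P).filter (fun p => Q < p), (1 - ((p : ℝ) ^ 2)⁻¹) <
      rexp eulerMascheroniConstant * Real.log (θ P + θ Q) := by
  have hP0 : P ≠ 0 := by intro h; rw [h] at hP; norm_num at hP
  have hP18 : P < 4 ^ 18 := by exact_mod_cast (lt_of_le_of_lt hPX hX18 : (P : ℝ) < (4 : ℝ) ^ 18)
  have hPl : 4 ^ Nat.log 4 P ≤ P := Nat.pow_log_le_self 4 hP0
  have hPu : P < 4 ^ (Nat.log 4 P + 1) := Nat.lt_pow_succ_log_self (by norm_num) P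
  have hk11 : 11 ≤ Nat.log 4 P := by
    by_contra h; rw [not_le] at h
    have : 4 ^ (Nat.log 4 P + 1) ≤ 4 ^ 11 := Nat.pow_le_pow_right (by norm_num) (by omega)
    omega
  have hk17 : Nat.log 4 P ≤ 17 := by
    by_contra h; rw [not_le] at h
    have : 4 ^ 18 ≤ 4 ^ Nat.log 4 P := Nat.pow_le_pow_right (by norm_num) (by omega)
    omega
  have hkX : (4 : ℝ) ^ Nat.log 4 P ≤ X := le_trans (by exact_mod_cast hPl) hPX
  have hPY : (P : ℝ) ≤ min X ((4 : ℝ) ^ (Nat.log 4 P + 1)) := le_min hPX (by exact_mod_cast hPu.le)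
  exact mertensProdLt_levelS hB hK hT hRH hk11 hk17 (hcell _ hk11 hk17 hkX) hPl hPu.le hPY hQP

open scoped ArithmeticFunction.sigma in
/-- **THE LIFTED LOW-HEIGHT CA-SIDE HEIGHT LAW.  RH verified to ANY height `T ≥ 10⁵` + {Büthe 2018 Thm 2, BKLNW 2021} ⟹ Robin's
inequality at every colossally abundant `N > 5040` all of whose primes are `≤ X`**, for every natural `X < 4¹⁸` passing the lifted
level conditions of the levels `≤ X` (top level partial).  Bookkeeping of `robinCA_below_low` with `mertensProdLt_lowS`; primes
`< 4¹¹` by the kernel theorem `robinCA_below_four_pow_eleven`.  No conjecture in hypothesis position. -/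
theorem robinCA_below_lowS (hB : Buthe2018_thm2_theta) (hK : BroadbentEtAl2021_theta_rel_1e19)
    {T : ℝ} (hT : 100000 ≤ T) (hRH : RiemannHypothesisUpTo T) {X : ℕ} (hX18 : (X : ℝ) < (4 : ℝ) ^ 18)
    (hcell : ∀ k : ℕ, 11 ≤ k → k ≤ 17 → (4 : ℝ) ^ k ≤ (X : ℝ) → 0.0463 + (1 + 2 / ((L1 k : ℚ) : ℝ)) *
      ((((Real.log (T / (2 * π)) + 1) / (π * T) + (184 + 30 * Real.log T) / T ^ 2)) * √(min (X : ℝ) ((4 : ℝ) ^ (k + 1)))) ≤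
        ((bkS k : ℚ) : ℝ)) :
    robinCA_below (X + 1) := by
  intro N hCA h5040 hprimes
  obtain ⟨ε, P, Q, -, -, hP, hPN, -, hQP, hpf, -, -, hσ, hθ, -⟩ := hCA.exists_structure
  by_cases hsmall : P < 4 ^ 11
  · refine robinCA_below_four_pow_eleven N hCA h5040 fun p hp hpN => lt_of_le_of_lt ?_ hsmall
    have hN0 : N ≠ 0 := by omega
    have : p ∈ N.primeFactors := Nat.mem_primeFactors.2 ⟨hp, hpN, hN0⟩
    rw [hpf] at this
    exact (Nat.mem_primesLE.1 this).1
  · rw [not_lt] at hsmall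
    have hPX : (P : ℝ) ≤ X := by
      have := hprimes P hP hPN
      exact_mod_cast Nat.lt_succ_iff.1 this
    have hlt := mertensProdLt_lowS hB hK hT hRH hX18 hcell hsmall hPX hQP
    have hN0 : N ≠ 0 := by omega
    have hNpos : (0 : ℝ) < N := by exact_mod_cast Nat.pos_of_ne_zero hN0
    have hθpos : 0 < θ P + θ Q := by
      have h1 : 0 < θ (P : ℝ) := Chebyshev.theta_pos (by exact_mod_cast hP.two_le)
      have h2 : 0 ≤ θ (Q : ℝ) := Chebyshev.theta_nonneg _
      linarith
    have hlog : Real.log (θ P + θ Q) ≤ Real.log (Real.log N) := Real.log_le_log hθpos hθ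
    have hlt' : (σ 1 N : ℝ) / N < rexp eulerMascheroniConstant * Real.log (Real.log N) :=
      lt_of_le_of_lt hσ (hlt.trans_le (mul_le_mul_of_nonneg_left hlog (Real.exp_pos _).le))
    unfold robinInequality
    rw [div_lt_iff₀ hNpos] at hlt'
    linarith

/-- Lifted per-level tail tolerances `(b'_k − 0.0463)/((1 + 2/L1 k)·2ᵏ⁺¹)` rounded down (exact: `3.4900·10⁻⁵, 3.1133·10⁻⁵,
1.9706·10⁻⁵, 1.1473·10⁻⁵, 6.3712·10⁻⁶, 3.4411·10⁻⁶, 1.8204·10⁻⁶`; the tree's `tolK`: `1.266·10⁻⁵ … 1.595·10⁻⁶`):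
a FULL level `k` passes as soon as `tailH(T) ≤ tolS k`. -/
def tolS : ℕ → ℚ
  | 11 => 3490 / 10 ^ 8 | 12 => 3113 / 10 ^ 8 | 13 => 1970 / 10 ^ 8 | 14 => 1147 / 10 ^ 8
  | 15 => 6371 / 10 ^ 9 | 16 => 3441 / 10 ^ 9 | 17 => 1820 / 10 ^ 9 | _ => 0

/-- The (full) lifted level condition from the tolerance. -/
theorem levelS_of_tol {t X : ℝ} {k : ℕ} (hk11 : 11 ≤ k) (hk17 : k ≤ 17) (ht0 : 0 ≤ t) (ht : t ≤ ((tolS k : ℚ) : ℝ)) :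
    0.0463 + (1 + 2 / ((L1 k : ℚ) : ℝ)) * (t * √(min X ((4 : ℝ) ^ (k + 1)))) ≤ ((bkS k : ℚ) : ℝ) := by
  have hL₁8 := (range_facts (k := k) (by omega)).2.2.2.2.1
  have hs : √(min X ((4 : ℝ) ^ (k + 1))) ≤ 2 ^ (k + 1) := by
    rw [← sqrt_four_pow]; exact Real.sqrt_le_sqrt (min_le_right _ _)
  have hfac0 : (0 : ℝ) ≤ 1 + 2 / ((L1 k : ℚ) : ℝ) := by
    have : (0 : ℝ) ≤ 2 / ((L1 k : ℚ) : ℝ) := div_nonneg (by norm_num) (by linarith)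
    linarith
  have h1 : (1 + 2 / ((L1 k : ℚ) : ℝ)) * (t * √(min X ((4 : ℝ) ^ (k + 1)))) ≤
      (1 + 2 / ((L1 k : ℚ) : ℝ)) * (t * 2 ^ (k + 1)) :=
    mul_le_mul_of_nonneg_left (mul_le_mul_of_nonneg_left hs ht0) hfac0
  have h2 : 0.0463 + (1 + 2 / ((L1 k : ℚ) : ℝ)) * (t * 2 ^ (k + 1)) ≤ ((bkS k : ℚ) : ℝ) := by
    interval_cases k <;>
      · simp only [tolS, bkS, L1, l2] at ht ⊢; push_cast at ht ⊢; norm_num at ht ⊢; nlinarith [ht]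
  linarith

/-- **Cells-only range at height `T` on the lifted budgets**: if every level `11 ≤ k ≤ K` (`K ≤ 17`) has `tailH(T) ≤ tolS k`,
then Robin holds at every CA number `> 5040` with primes `< 4^{K+1}`. -/
theorem robinCA_below_cellsS (hB : Buthe2018_thm2_theta) (hK : BroadbentEtAl2021_theta_rel_1e19)
    {T : ℝ} (hT : 100000 ≤ T) (hRH : RiemannHypothesisUpTo T) {K : ℕ} (hK11 : 11 ≤ K) (hK17 : K ≤ 17)
    (htol : ∀ k : ℕ, 11 ≤ k → k ≤ K →
      (Real.log (T / (2 * π)) + 1) / (π * T) + (184 + 30 * Real.log T) / T ^ 2 ≤ ((tolS k : ℚ) : ℝ)) :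
    robinCA_below (4 ^ (K + 1)) := by
  have hT7 : (7 : ℝ) ≤ T := by linarith
  have ht0 := Summit.RiemannHypothesis.RiemannHypothesis.Theorems.Splittings.RobinFiniteTail.tailH_nonneg hT7
  have h1 : 1 ≤ 4 ^ (K + 1) := Nat.one_le_pow _ _ (by norm_num)
  rw [← Nat.sub_add_cancel h1]
  set X : ℕ := 4 ^ (K + 1) - 1 with hX_def
  have hXr : (X : ℝ) = (4 : ℝ) ^ (K + 1) - 1 := by
    rw [hX_def, Nat.cast_sub h1]; push_cast; ring
  have hX18 : (X : ℝ) < (4 : ℝ) ^ 18 := by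
    rw [hXr]; have : (4 : ℝ) ^ (K + 1) ≤ 4 ^ 18 := pow_le_pow_right₀ (by norm_num) (by omega); linarith
  refine robinCA_below_lowS hB hK hT hRH (X := X) hX18 ?_
  intro k hk11 hk17 hkX
  have hkK : k ≤ K := by
    by_contra h
    rw [not_le] at h
    have : (4 : ℝ) ^ (K + 1) ≤ 4 ^ k := pow_le_pow_right₀ (by norm_num) (by omega)
    rw [hXr] at hkX; linarith
  exact levelS_of_tol hk11 hk17 ht0 (htol k hk11 hkK)

/-! #### The rows (all with `RH(T)` in hypothesis position; nothing here bears on the truth of RH) -/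

/-- **RH to height `10⁵` — the tree's KERNEL height — ⟹ Robin at every CA number `> 5040` with primes `< 4¹² = 16 777 216`**
(level 11 in full: `tailH(10⁵) ≤ 3.42·10⁻⁵ ≤ tolS 11 = 3.49·10⁻⁵`; the tree's level 11 needed `T ≥ 330 000`). -/
theorem robinCA_below_of_rh100000S (hB : Buthe2018_thm2_theta) (hK : BroadbentEtAl2021_theta_rel_1e19)
    {T : ℝ} (hT : 100000 ≤ T) (hRH : RiemannHypothesisUpTo T) : robinCA_below (4 ^ 12) := by
  have hRH' : RiemannHypothesisUpTo 100000 := RiemannHypothesisUpTo.mono_of_le hT hRH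
  have ht := Summit.RiemannHypothesis.RiemannHypothesis.Theorems.Splittings.RobinFiniteTail.tailH_1e5_le
  refine robinCA_below_cellsS hB hK (T := 100000) le_rfl hRH' (K := 11) le_rfl (by norm_num) fun k hk11 hk13 => ?_
  refine ht.trans ?_
  interval_cases k; simp only [tolS]; push_cast; norm_num

/-- **RH to height `10⁵` ⟹ Robin at every CA number `> 5040` with primes `≤ 5.5·10⁷`** — level 11 in full and the PARTIAL
level 12 up to `X = 55 000 000` (`0.0463 + (1 + 2/L1 12)·3.42·10⁻⁵·√X ≤ 0.3305 ≤ b'₁₂ = 0.332`). -/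
theorem robinCA_below_55e6_of_rh100000 (hB : Buthe2018_thm2_theta) (hK : BroadbentEtAl2021_theta_rel_1e19)
    {T : ℝ} (hT : 100000 ≤ T) (hRH : RiemannHypothesisUpTo T) : robinCA_below (55000000 + 1) := by
  have hRH' : RiemannHypothesisUpTo 100000 := RiemannHypothesisUpTo.mono_of_le hT hRH
  have ht := Summit.RiemannHypothesis.RiemannHypothesis.Theorems.Splittings.RobinFiniteTail.tailH_1e5_le
  have ht0 := Summit.RiemannHypothesis.RiemannHypothesis.Theorems.Splittings.RobinFiniteTail.tailH_nonneg
    (T := 100000) (by norm_num)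
  refine robinCA_below_lowS hB hK (T := 100000) le_rfl hRH' (X := 55000000) (by norm_num) ?_
  intro k hk11 hk17 hkX
  have hk12 : k ≤ 12 := by
    by_contra h
    rw [not_le] at h
    have h13 : (67108864 : ℝ) ≤ (4 : ℝ) ^ k :=
      calc (67108864 : ℝ) = (4 : ℝ) ^ 13 := by norm_num
        _ ≤ (4 : ℝ) ^ k := pow_le_pow_right₀ (by norm_num) (by omega)
    have hkX' : (4 : ℝ) ^ k ≤ 55000000 := by exact_mod_cast hkX
    linarith
  set t : ℝ := (Real.log (100000 / (2 * π)) + 1) / (π * 100000) + (184 + 30 * Real.log 100000) / 100000 ^ 2 with ht_def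
  have hts0 : 0 ≤ t * √(min ((55000000 : ℕ) : ℝ) ((4 : ℝ) ^ (k + 1))) := mul_nonneg ht0 (Real.sqrt_nonneg _)
  interval_cases k
  · have hs : √(min ((55000000 : ℕ) : ℝ) ((4 : ℝ) ^ (11 + 1))) ≤ 4096 := by
      rw [show (4096 : ℝ) = 2 ^ (11 + 1) by norm_num, ← sqrt_four_pow]
      exact Real.sqrt_le_sqrt (min_le_right _ _)
    have hprod : t * √(min ((55000000 : ℕ) : ℝ) ((4 : ℝ) ^ (11 + 1))) ≤ 3.42e-5 * 4096 :=
      mul_le_mul ht hs (Real.sqrt_nonneg _) (by norm_num)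
    have hfac : 1 + 2 / ((L1 11 : ℚ) : ℝ) ≤ 1.1312 := by simp only [L1, l2]; push_cast; norm_num
    have hfac0 : (0 : ℝ) ≤ 1 + 2 / ((L1 11 : ℚ) : ℝ) := by simp only [L1, l2]; push_cast; norm_num
    have key := mul_le_mul hfac hprod hts0 (by norm_num)
    have hb : ((bkS 11 : ℚ) : ℝ) = 0.208 := by simp only [bkS]; push_cast; norm_num
    rw [hb]; linarith
  · have hs : √(min ((55000000 : ℕ) : ℝ) ((4 : ℝ) ^ (12 + 1))) ≤ 7417 := by
      refine (Real.sqrt_le_sqrt (min_le_left _ _)).trans ?_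
      calc √((55000000 : ℕ) : ℝ) ≤ √((7417 : ℝ) ^ 2) := Real.sqrt_le_sqrt (by norm_num)
        _ = 7417 := Real.sqrt_sq (by norm_num)
    have hprod : t * √(min ((55000000 : ℕ) : ℝ) ((4 : ℝ) ^ (12 + 1))) ≤ 3.42e-5 * 7417 :=
      mul_le_mul ht hs (Real.sqrt_nonneg _) (by norm_num)
    have hfac : 1 + 2 / ((L1 12 : ℚ) : ℝ) ≤ 1.1203 := by simp only [L1, l2]; push_cast; norm_num
    have hfac0 : (0 : ℝ) ≤ 1 + 2 / ((L1 12 : ℚ) : ℝ) := by simp only [L1, l2]; push_cast; norm_num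
    have key := mul_le_mul hfac hprod hts0 (by norm_num)
    have hb : ((bkS 12 : ℚ) : ℝ) = 0.332 := by simp only [bkS]; push_cast; norm_num
    rw [hb]; linarith

/-- **RH to height `10⁵` + {Büthe 2018 Thm 2, BKLNW 2021} ⟹ Robin's inequality for every `5040 < n` with
`log n ≤ 0.99947·(5.5·10⁷ − 1)`, i.e. up to about `10^(2.38·10⁷)`** (`robin_all_of_robinCA_below_low`). -/
theorem robin_le_of_rh100000S (hB : Buthe2018_thm2_theta) (hK : BroadbentEtAl2021_theta_rel_1e19)
    {T : ℝ} (hT : 100000 ≤ T) (hRH : RiemannHypothesisUpTo T) :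
    ∀ n : ℕ, 5040 < n → Real.log n ≤ 0.99947 * ((55000000 : ℝ) - 1) → robinInequality n := by
  have h := robin_all_of_robinCA_below_low hB hK (robinCA_below_55e6_of_rh100000 hB hK hT hRH) (by norm_num)
  intro n hn hlog
  exact h n hn (by exact_mod_cast hlog)

/-- **All-integer currency: RH to height `10⁵` + the two print `θ`-facts ⟹ Robin's inequality for every `5040 < n ≤ 10^23 870 000`**
(`23 870 000·log 10 ≤ 54 962 707 ≤ 0.99947·54 999 999`; the power is never evaluated — `log_le_of_le_ten_pow`).  Tree, same currency:
`robin_le_PT2` (`n ≤ 10^(10²²)` from RH to `3·10¹²`); gen 15 (lane (ix-i), not yet landed): `10^3 845 000` from `RH(10⁵)` print-free. -/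
theorem robin_le_ten_pow_of_rh100000S (hB : Buthe2018_thm2_theta) (hK : BroadbentEtAl2021_theta_rel_1e19)
    {T : ℝ} (hT : 100000 ≤ T) (hRH : RiemannHypothesisUpTo T) :
    ∀ n : ℕ, 5040 < n → n ≤ 10 ^ 23870000 → robinInequality n := by
  intro n hn hle
  have hn0 : 0 < n := lt_of_le_of_lt (Nat.zero_le 5040) hn
  have h1 : Real.log n ≤ ((23870000 : ℕ) : ℝ) * Real.log 10 := log_le_of_le_ten_pow hn0 hle
  clear hle
  refine robin_le_of_rh100000S hB hK hT hRH n hn ?_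
  have h10 := RobinAnalytic.log_ten_lt
  have h9 : ((23870000 : ℕ) : ℝ) = 23870000 := by norm_num
  rw [h9] at h1
  nlinarith

/-- **RH to height `124 000` ⟹ Robin at CA numbers with primes `< 4¹³ = 67 108 864`** (`tailH ≤ 12/(π·124000) = 3.080·10⁻⁵ ≤
tolS 12`; tree: no level-12 row below `T = 330 000`). -/
theorem robinCA_below_of_rh124000S (hB : Buthe2018_thm2_theta) (hK : BroadbentEtAl2021_theta_rel_1e19)
    {T : ℝ} (hT : 124000 ≤ T) (hRH : RiemannHypothesisUpTo T) : robinCA_below (4 ^ 13) := by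
  have hπ := Real.pi_gt_d6
  refine robinCA_below_cellsS hB hK (by linarith) hRH (K := 12) (by norm_num) (by norm_num) fun k hk11 hk13 => ?_
  refine (tailH_le_of_height (n := 12) (by norm_num) (by norm_num) hT).trans ?_
  rw [div_le_iff₀ (by positivity)]
  interval_cases k <;> · simp only [tolS]; push_cast; nlinarith

/-- **RH to height `212 000` ⟹ Robin at CA numbers with primes `< 4¹⁴ = 268 435 456`** (`13/(π·212000) = 1.952·10⁻⁵ ≤ tolS 13`;
tree `robinCA_below_of_rh330000`). -/
theorem robinCA_below_of_rh212000S (hB : Buthe2018_thm2_theta) (hK : BroadbentEtAl2021_theta_rel_1e19)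
    {T : ℝ} (hT : 212000 ≤ T) (hRH : RiemannHypothesisUpTo T) : robinCA_below (4 ^ 14) := by
  have hπ := Real.pi_gt_d6
  refine robinCA_below_cellsS hB hK (by linarith) hRH (K := 13) (by norm_num) (by norm_num) fun k hk11 hk13 => ?_
  refine (tailH_le_of_height (n := 13) (by norm_num) (by norm_num) hT).trans ?_
  rw [div_le_iff₀ (by positivity)]
  interval_cases k <;> · simp only [tolS]; push_cast; nlinarith

/-- **RH to height `364 000` ⟹ Robin at CA numbers with primes `< 4¹⁵ ≈ 1.07·10⁹`** (`13/(π·364000) = 1.137·10⁻⁵ ≤ tolS 14`;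
tree `robinCA_below_of_rh500000`). -/
theorem robinCA_below_of_rh364000S (hB : Buthe2018_thm2_theta) (hK : BroadbentEtAl2021_theta_rel_1e19)
    {T : ℝ} (hT : 364000 ≤ T) (hRH : RiemannHypothesisUpTo T) : robinCA_below (4 ^ 15) := by
  have hπ := Real.pi_gt_d6
  refine robinCA_below_cellsS hB hK (by linarith) hRH (K := 14) (by norm_num) (by norm_num) fun k hk11 hk13 => ?_
  refine (tailH_le_of_height (n := 13) (by norm_num) (by norm_num) hT).trans ?_
  rw [div_le_iff₀ (by positivity)]
  interval_cases k <;> · simp only [tolS]; push_cast; nlinarith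

/-- **RH to height `705 000` ⟹ Robin at CA numbers with primes `< 4¹⁶ ≈ 4.29·10⁹`** (`14/(π·705000) = 6.321·10⁻⁶ ≤ tolS 15`;
tree `robinCA_below_of_rh860000`). -/
theorem robinCA_below_of_rh705000S (hB : Buthe2018_thm2_theta) (hK : BroadbentEtAl2021_theta_rel_1e19)
    {T : ℝ} (hT : 705000 ≤ T) (hRH : RiemannHypothesisUpTo T) : robinCA_below (4 ^ 16) := by
  have hπ := Real.pi_gt_d6
  refine robinCA_below_cellsS hB hK (by linarith) hRH (K := 15) (by norm_num) (by norm_num) fun k hk11 hk13 => ?_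
  refine (tailH_le_of_height (n := 14) (by norm_num) (by norm_num) hT).trans ?_
  rw [div_le_iff₀ (by positivity)]
  interval_cases k <;> · simp only [tolS]; push_cast; nlinarith

/-- **RH to height `1 400 000` ⟹ Robin at CA numbers with primes `< 4¹⁷ ≈ 1.72·10¹⁰`** (`15/(π·1.4·10⁶) = 3.410·10⁻⁶ ≤ tolS 16`;
tree `robinCA_below_of_rh1620000`). -/
theorem robinCA_below_of_rh1400000S (hB : Buthe2018_thm2_theta) (hK : BroadbentEtAl2021_theta_rel_1e19)
    {T : ℝ} (hT : 1400000 ≤ T) (hRH : RiemannHypothesisUpTo T) : robinCA_below (4 ^ 17) := by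
  have hπ := Real.pi_gt_d6
  refine robinCA_below_cellsS hB hK (by linarith) hRH (K := 16) (by norm_num) (by norm_num) fun k hk11 hk13 => ?_
  refine (tailH_le_of_height (n := 15) (by norm_num) (by norm_num) hT).trans ?_
  rw [div_le_iff₀ (by positivity)]
  interval_cases k <;> · simp only [tolS]; push_cast; nlinarith

/-- **RH to height `2 650 000` ⟹ Robin at CA numbers with primes `< 4¹⁸ ≈ 6.87·10¹⁰`** — all seven certified levels
(`15/(π·2.65·10⁶) = 1.802·10⁻⁶ ≤ tolS 17 = 1.820·10⁻⁶`; tree `robinCA_below_of_rh3000000`). -/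
theorem robinCA_below_of_rh2650000S (hB : Buthe2018_thm2_theta) (hK : BroadbentEtAl2021_theta_rel_1e19)
    {T : ℝ} (hT : 2650000 ≤ T) (hRH : RiemannHypothesisUpTo T) : robinCA_below (4 ^ 18) := by
  have hπ := Real.pi_gt_d6
  refine robinCA_below_cellsS hB hK (by linarith) hRH (K := 17) (by norm_num) (by norm_num) fun k hk11 hk13 => ?_
  refine (tailH_le_of_height (n := 15) (by norm_num) (by norm_num) hT).trans ?_
  rw [div_le_iff₀ (by positivity)]
  interval_cases k <;> · simp only [tolS]; push_cast; nlinarith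

end SqrtWindowLaw

end Summit.RiemannHypothesis.RiemannHypothesis.Theorems.Splittings.RobinFiniteC1

/-! ### Standard-axiom guards (RH(T) in hypothesis position; no kernel certificate is imported by this file) -/

/-- info: 'Summit.RiemannHypothesis.RiemannHypothesis.Theorems.Splittings.RobinFiniteC1.robinCA_below_55e6_of_rh100000' depends on axioms: [propext, Classical.choice, Quot.sound] -/
#guard_msgs (whitespace := lax) in
#print axioms Summit.RiemannHypothesis.RiemannHypothesis.Theorems.Splittings.RobinFiniteC1.robinCA_below_55e6_of_rh100000

/-- info: 'Summit.RiemannHypothesis.RiemannHypothesis.Theorems.Splittings.RobinFiniteC1.robin_le_of_rh100000S' depends on axioms: [propext, Classical.choice, Quot.sound] -/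
#guard_msgs (whitespace := lax) in
#print axioms Summit.RiemannHypothesis.RiemannHypothesis.Theorems.Splittings.RobinFiniteC1.robin_le_of_rh100000S

/-- info: 'Summit.RiemannHypothesis.RiemannHypothesis.Theorems.Splittings.RobinFiniteC1.robin_le_ten_pow_of_rh100000S' depends on axioms: [propext, Classical.choice, Quot.sound] -/
#guard_msgs (whitespace := lax) in
#print axioms Summit.RiemannHypothesis.RiemannHypothesis.Theorems.Splittings.RobinFiniteC1.robin_le_ten_pow_of_rh100000S

/-- info: 'Summit.RiemannHypothesis.RiemannHypothesis.Theorems.Splittings.RobinFiniteC1.robinCA_below_of_rh2650000S' depends on axioms: [propext, Classical.choice, Quot.sound] -/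
#guard_msgs (whitespace := lax) in
#print axioms Summit.RiemannHypothesis.RiemannHypothesis.Theorems.Splittings.RobinFiniteC1.robinCA_below_of_rh2650000S

end
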